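import Mathlib.Data.Real.Basic
import Mathlib.Order.Interval.Set.Basic
import Mathlib.Tactic
import HarnessLib

/-!
# Three-band → one-band by CELL PERTURBATION ("technique A"): fourth-order closed forms, their
# monotonicity, and the MIXED-CORNER enclosure rule of the parameter-box grammar

Venture CertifiedManyBodySolver, cell `pub/hubbard-downfold` (stage S1 = downfolding front end; HUMAN
RULINGS D-0096/D-0098: the three-band → one-band reduction error is carried as explicit box
inflation, never hidden), seat hubbard-downfold-mod-3; namespaces
`Summit.Ventures.CertifiedManyBodySolver.Downfold.MixedCorner` (§1, general) and
`Summit.Ventures.CertifiedManyBodySolver.Downfold.EmeryCell` (§2, the closed forms). Everything here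
is PROVED (elementary real inequalities). WHAT THIS IS NOT: a statement about any material (no
literature number is load-bearing; the one numerical `example` only exhibits that the closed form
evaluates); not the band-level reduction (technique B, seat mod-4:
`Downfold.EmeryBlochBand`, `Downfold.EmeryBandReduction`); not a claim that the fourth-order forms
give VALUES — at cuprate parameters `t_pd/Δ ≈ 0.35–0.55` they are off by a factor ≈ 2 against
cluster exact diagonalisation (cell file `router/INFLATION-RULES.md` §3to1-A A.1: SIGNS /
MONOTONICITY / SENSITIVITIES ONLY); the many-body cluster and torus maps of that section (A.7–A.9)
are kit computations, not Lean objects.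

* §1 `MixedCorner` — the reusable rule behind every "two corner evaluations enclose the image"
  line of the cell's box files, for ANY index type `ι`: a map `f : (ι → ℝ) → ℝ` that is
  non-decreasing in the coordinates marked `σ i = true` and non-increasing in the others
  (`MixedMonotoneOn σ lo hi f`, stated through the σ-twisted order `MixedLE`) takes on the product
  box `boxMem lo hi` values between `f (cornerLo σ lo hi)` and `f (cornerHi σ lo hi)`
  (`corner_enclosure`); a DIFFERENCE `g − h` of two such maps with possibly different sign
  patterns — which need not be monotone in any coordinate (technique B's `t′ = (2ε_X − ε_M)/16`,
  reviewer unc-3 R4) — is enclosed by four corner evaluations (`diff_enclosure`; `add_enclosure`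
  for sums). `boxMem_iff` identifies the box with Mathlib's `Set.Icc lo hi` in the product order.
  Seat mod-4's `tpB_mem_Icc_of_box_mixed` is the hand-specialised instance for three named reals.
* §2 `EmeryCell` — the cell-perturbation (Zhang–Rice) closed forms of the three-band (Emery) model
  in the hole picture, charge-transfer energy `Δ > 0`, Cu–O hopping `t_pd`, on-site `U_d`, `U_p`:
  `tP Δ tpd = tpd²/Δ` (second-order O-mediated scale), `tZR = tP/2` (Zhang–Rice singlet hopping),
  `J4 Δ tpd Ud Up = 4 tpd⁴/Δ² · (1/Ud + 2/(2Δ + Up))` (fourth-order superexchange, both the Cu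
  double-occupancy and the two-holes-on-oxygen channels), `Ueff Δ Ud Up = (4 (1/Ud + 2/(2Δ+Up)))⁻¹`
  (the `t–J`-consistent one-band `U`: `4 tZR² / J4 = Ueff`, `four_tZR_sq_div_J4` — independent of
  `t_pd`). Monotonicity on the positive orthant (`tP`/`tZR`: ↑ in `tpd ≥ 0`, ↓ in `Δ`; `J4`: ↑ in
  `tpd ≥ 0`, ↓ in `Δ`, `Ud`, `Up`; `Ueff`: ↑ in `Δ`, `Ud`, `Up`) and the CORNER ENCLOSURES on a box
  `[Δlo,Δhi] × [alo,ahi] × [ulo,uhi] × [vlo,vhi]` (`tZR_mem_Icc_of_box`, `J4_mem_Icc_of_box`,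
  `Ueff_mem_Icc_of_box`) = the statements the cell file cites as "farm-checked" in §3to1-A A.1.

Sources: F. C. Zhang, T. M. Rice, Phys. Rev. B 37, 3759 (1988) (singlet and `t`); H. Eskes,
J. H. Jefferson, Phys. Rev. B 48, 9788 (1993) and the textbook normalisation recorded in the cell's
`lit/REFVALS-1.md` C6 (fourth-order `J` with the `2/(2Δ+U_p)` channel); E. Dagotto, Rev. Mod. Phys.
66, 763 (1994) p. 9–10 (the HSSJ parameter set used in the `example`). The forms are [folklore] at
this level; no `cite` key is load-bearing.
-/

namespace Summit.Ventures.CertifiedManyBodySolver.Downfold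

/-! ## §1 Mixed-monotone maps on a product box: corner and difference enclosures -/

namespace MixedCorner

variable {ι : Type*}

/-- Membership of a point `p : ι → ℝ` in the closed product box `∏ i, [lo i, hi i]`. -/
def boxMem (lo hi p : ι → ℝ) : Prop := ∀ i, lo i ≤ p i ∧ p i ≤ hi i

/-- `boxMem lo hi p` is membership in Mathlib's order interval `Set.Icc lo hi` of the product
(pointwise) order on `ι → ℝ`. -/
theorem boxMem_iff (lo hi p : ι → ℝ) : boxMem lo hi p ↔ p ∈ Set.Icc lo hi := by
  simp only [boxMem, Set.mem_Icc, Pi.le_def]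
  exact ⟨fun h => ⟨fun i => (h i).1, fun i => (h i).2⟩, fun h i => ⟨h.1 i, h.2 i⟩⟩

/-- The corner of the box at which a `σ`-mixed-monotone map is smallest: `lo i` on the
coordinates where the map is non-decreasing (`σ i = true`), `hi i` on the others. -/
def cornerLo (σ : ι → Bool) (lo hi : ι → ℝ) : ι → ℝ := fun i => if σ i then lo i else hi i

/-- The corner of the box at which a `σ`-mixed-monotone map is largest: `hi i` where
`σ i = true`, `lo i` elsewhere. -/
def cornerHi (σ : ι → Bool) (lo hi : ι → ℝ) : ι → ℝ := fun i => if σ i then hi i else lo i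

/-- The `σ`-twisted product order: `MixedLE σ p q` iff `p i ≤ q i` on the `σ`-true coordinates and
`q i ≤ p i` on the `σ`-false ones. -/
def MixedLE (σ : ι → Bool) (p q : ι → ℝ) : Prop := ∀ i, if σ i then p i ≤ q i else q i ≤ p i

/-- `f` is `σ`-MIXED-MONOTONE on the box `[lo, hi]`: between box points, `f` respects the
`σ`-twisted order (non-decreasing in the `σ`-true coordinates, non-increasing in the others). -/
def MixedMonotoneOn (σ : ι → Bool) (lo hi : ι → ℝ) (f : (ι → ℝ) → ℝ) : Prop :=
  ∀ p q, boxMem lo hi p → boxMem lo hi q → MixedLE σ p q → f p ≤ f q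

/-- The lower `σ`-corner lies in the box (when the box is non-empty coordinatewise). -/
theorem cornerLo_mem {σ : ι → Bool} {lo hi : ι → ℝ} (h : ∀ i, lo i ≤ hi i) :
    boxMem lo hi (cornerLo σ lo hi) := by
  intro i; unfold cornerLo; by_cases hs : σ i <;> simp [hs, h i]

/-- The upper `σ`-corner lies in the box. -/
theorem cornerHi_mem {σ : ι → Bool} {lo hi : ι → ℝ} (h : ∀ i, lo i ≤ hi i) :
    boxMem lo hi (cornerHi σ lo hi) := by
  intro i; unfold cornerHi; by_cases hs : σ i <;> simp [hs, h i]

/-- Every box point lies `σ`-above the lower `σ`-corner. -/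
theorem cornerLo_mixedLE {σ : ι → Bool} {lo hi p : ι → ℝ} (hp : boxMem lo hi p) :
    MixedLE σ (cornerLo σ lo hi) p := by
  intro i; unfold cornerLo; by_cases hs : σ i <;> simp [hs, (hp i).1, (hp i).2]

/-- Every box point lies `σ`-below the upper `σ`-corner. -/
theorem mixedLE_cornerHi {σ : ι → Bool} {lo hi p : ι → ℝ} (hp : boxMem lo hi p) :
    MixedLE σ p (cornerHi σ lo hi) := by
  intro i; unfold cornerHi; by_cases hs : σ i <;> simp [hs, (hp i).1, (hp i).2]

/-- **CORNER ENCLOSURE.** A `σ`-mixed-monotone map on a product box takes, at every box point, a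
value between its values at the two opposite `σ`-corners: the whole image is enclosed by TWO
evaluations, no sampling (cell file `router/INFLATION-RULES.md` §3to1-A A.1 "corner-enclosure
lemma"; `REDUCTION-MAP.md` §3.4). -/
theorem corner_enclosure {σ : ι → Bool} {lo hi : ι → ℝ} {f : (ι → ℝ) → ℝ}
    (hf : MixedMonotoneOn σ lo hi f) {p : ι → ℝ} (hp : boxMem lo hi p) :
    f p ∈ Set.Icc (f (cornerLo σ lo hi)) (f (cornerHi σ lo hi)) := by
  have hbox : ∀ i, lo i ≤ hi i := fun i => (hp i).1.trans (hp i).2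
  exact ⟨hf _ _ (cornerLo_mem hbox) hp (cornerLo_mixedLE hp),
    hf _ _ hp (cornerHi_mem hbox) (mixedLE_cornerHi hp)⟩

/-- Scaling by a nonnegative constant preserves `σ`-mixed-monotonicity. -/
theorem MixedMonotoneOn.const_mul {σ : ι → Bool} {lo hi : ι → ℝ} {f : (ι → ℝ) → ℝ}
    (hf : MixedMonotoneOn σ lo hi f) {c : ℝ} (hc : 0 ≤ c) :
    MixedMonotoneOn σ lo hi (fun p => c * f p) :=
  fun p q hp hq hpq => mul_le_mul_of_nonneg_left (hf p q hp hq hpq) hc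

/-- The sum of two maps with the SAME sign pattern is mixed-monotone with that pattern. -/
theorem MixedMonotoneOn.add {σ : ι → Bool} {lo hi : ι → ℝ} {f g : (ι → ℝ) → ℝ}
    (hf : MixedMonotoneOn σ lo hi f) (hg : MixedMonotoneOn σ lo hi g) :
    MixedMonotoneOn σ lo hi (fun p => f p + g p) :=
  fun p q hp hq hpq => add_le_add (hf p q hp hq hpq) (hg p q hp hq hpq)

/-- **DIFFERENCE-OF-MONOTONE (four-corner) ENCLOSURE.** If `g` is `σ`-mixed-monotone and `h` is
`τ`-mixed-monotone on the same box (the sign patterns may differ), then `g − h` — which need not be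
monotone in any coordinate — satisfies
`g (cornerLo σ) − h (cornerHi τ) ≤ g p − h p ≤ g (cornerHi σ) − h (cornerLo τ)` on the box. This is
the certified replacement for a grid check when a reduced coordinate is a difference of monotone
closed forms (technique B's `t′ = (2ε_X − ε_M)/16`; reviewer unc-3, R4). The enclosure is valid on
the whole box and generally wider than the true image; splitting the box and hulling refines it. -/
theorem diff_enclosure {σ τ : ι → Bool} {lo hi : ι → ℝ} {g h : (ι → ℝ) → ℝ}
    (hg : MixedMonotoneOn σ lo hi g) (hh : MixedMonotoneOn τ lo hi h) {p : ι → ℝ}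
    (hp : boxMem lo hi p) :
    g p - h p ∈ Set.Icc (g (cornerLo σ lo hi) - h (cornerHi τ lo hi))
      (g (cornerHi σ lo hi) - h (cornerLo τ lo hi)) := by
  obtain ⟨hg₁, hg₂⟩ := corner_enclosure hg hp
  obtain ⟨hh₁, hh₂⟩ := corner_enclosure hh hp
  exact ⟨by linarith, by linarith⟩

/-- Sum version of `diff_enclosure`: `g + h` with possibly different sign patterns is enclosed by
`g (cornerLo σ) + h (cornerLo τ)` and `g (cornerHi σ) + h (cornerHi τ)`. -/
theorem add_enclosure {σ τ : ι → Bool} {lo hi : ι → ℝ} {g h : (ι → ℝ) → ℝ}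
    (hg : MixedMonotoneOn σ lo hi g) (hh : MixedMonotoneOn τ lo hi h) {p : ι → ℝ}
    (hp : boxMem lo hi p) :
    g p + h p ∈ Set.Icc (g (cornerLo σ lo hi) + h (cornerLo τ lo hi))
      (g (cornerHi σ lo hi) + h (cornerHi τ lo hi)) := by
  obtain ⟨hg₁, hg₂⟩ := corner_enclosure hg hp
  obtain ⟨hh₁, hh₂⟩ := corner_enclosure hh hp
  exact ⟨by linarith, by linarith⟩

end MixedCorner

/-! ## §2 Technique A: the cell-perturbation closed forms -/

namespace EmeryCell

/-- Second-order O-mediated hopping scale of the three-band model, `t_P = t_pd² / Δ`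
(hole picture, charge-transfer energy `Δ = ε_p − ε_d > 0`). -/
noncomputable def tP (Δ tpd : ℝ) : ℝ := tpd ^ 2 / Δ

/-- Zhang–Rice singlet nearest-neighbour hopping at leading order, `t_ZR = t_P / 2`. -/
noncomputable def tZR (Δ tpd : ℝ) : ℝ := tP Δ tpd / 2

/-- The fourth-order channel factor `g = 1/U_d + 2/(2Δ + U_p)` (Cu double occupancy + two holes
on the bridging oxygen). -/
noncomputable def chan (Δ Ud Up : ℝ) : ℝ := 1 / Ud + 2 / (2 * Δ + Up)

/-- Fourth-order superexchange of the three-band model,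
`J₄ = 4 t_pd⁴ / Δ² · (1/U_d + 2/(2Δ + U_p))`. -/
noncomputable def J4 (Δ tpd Ud Up : ℝ) : ℝ := 4 * tpd ^ 4 / Δ ^ 2 * chan Δ Ud Up

/-- The `t–J`-consistent one-band repulsion `U_eff := 4 t_ZR² / J₄ = (4 (1/U_d + 2/(2Δ+U_p)))⁻¹`
(see `four_tZR_sq_div_J4`); it does not depend on `t_pd`. -/
noncomputable def Ueff (Δ Ud Up : ℝ) : ℝ := 1 / (4 * chan Δ Ud Up)

/-- The channel factor is positive on the positive orthant. -/
theorem chan_pos {Δ Ud Up : ℝ} (hΔ : 0 < Δ) (hUd : 0 < Ud) (hUp : 0 ≤ Up) :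
    0 < chan Δ Ud Up := by
  unfold chan
  have h1 : 0 < 1 / Ud := by positivity
  have h2 : 0 < 2 / (2 * Δ + Up) := by positivity
  linarith

/-- `t_P > 0` for `Δ > 0`, `t_pd ≠ 0`. -/
theorem tP_pos {Δ tpd : ℝ} (hΔ : 0 < Δ) (htpd : tpd ≠ 0) : 0 < tP Δ tpd := by
  unfold tP
  have : 0 < tpd ^ 2 := by positivity
  positivity

/-- `J₄ > 0` on the positive orthant (`t_pd ≠ 0`). -/
theorem J4_pos {Δ tpd Ud Up : ℝ} (hΔ : 0 < Δ) (htpd : tpd ≠ 0) (hUd : 0 < Ud) (hUp : 0 ≤ Up) :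
    0 < J4 Δ tpd Ud Up := by
  unfold J4
  have hc := chan_pos hΔ hUd hUp
  have : 0 < tpd ^ 4 := by positivity
  positivity

/-- The identity `4 t_ZR² / J₄ = U_eff`: the `t–J`-consistent one-band `U` of the fourth-order
forms is `(4 (1/U_d + 2/(2Δ+U_p)))⁻¹`, independent of `t_pd`. -/
theorem four_tZR_sq_div_J4 {Δ tpd Ud Up : ℝ} (hΔ : 0 < Δ) (htpd : tpd ≠ 0) (hUd : 0 < Ud)
    (hUp : 0 ≤ Up) : 4 * tZR Δ tpd ^ 2 / J4 Δ tpd Ud Up = Ueff Δ Ud Up := by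
  have hc := chan_pos hΔ hUd hUp
  unfold tZR tP J4 Ueff
  have h4 : tpd ^ 4 ≠ 0 := by positivity
  field_simp
  ring

/-- `t_P` is non-decreasing in `t_pd ≥ 0` and non-increasing in `Δ > 0`. -/
theorem tP_mono {Δ₁ Δ₂ a₁ a₂ : ℝ} (hΔ₁ : 0 < Δ₁) (ha₁ : 0 ≤ a₁) (ha : a₁ ≤ a₂) (hΔ : Δ₁ ≤ Δ₂) :
    tP Δ₂ a₁ ≤ tP Δ₁ a₂ := by
  unfold tP
  have hΔ₂ : 0 < Δ₂ := lt_of_lt_of_le hΔ₁ hΔ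
  gcongr

/-- `t_ZR` inherits the monotonicity of `t_P`. -/
theorem tZR_mono {Δ₁ Δ₂ a₁ a₂ : ℝ} (hΔ₁ : 0 < Δ₁) (ha₁ : 0 ≤ a₁) (ha : a₁ ≤ a₂) (hΔ : Δ₁ ≤ Δ₂) :
    tZR Δ₂ a₁ ≤ tZR Δ₁ a₂ := by
  unfold tZR
  have := tP_mono hΔ₁ ha₁ ha hΔ
  linarith

/-- The channel factor is non-increasing in `Δ`, `U_d`, `U_p` on the positive orthant. -/
theorem chan_anti {Δ₁ Δ₂ u₁ u₂ v₁ v₂ : ℝ} (hΔ₁ : 0 < Δ₁) (hu₁ : 0 < u₁) (hv₁ : 0 ≤ v₁)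
    (hΔ : Δ₁ ≤ Δ₂) (hu : u₁ ≤ u₂) (hv : v₁ ≤ v₂) : chan Δ₂ u₂ v₂ ≤ chan Δ₁ u₁ v₁ := by
  unfold chan
  have : 0 < 2 * Δ₁ + v₁ := by linarith
  gcongr

/-- `J₄` is non-decreasing in `t_pd ≥ 0` and non-increasing in `Δ`, `U_d`, `U_p` on the positive
orthant: the largest value on a box sits at (largest `t_pd`; smallest `Δ, U_d, U_p`). -/
theorem J4_mono {Δ₁ Δ₂ a₁ a₂ u₁ u₂ v₁ v₂ : ℝ} (hΔ₁ : 0 < Δ₁) (ha₁ : 0 ≤ a₁) (hu₁ : 0 < u₁)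
    (hv₁ : 0 ≤ v₁) (hΔ : Δ₁ ≤ Δ₂) (ha : a₁ ≤ a₂) (hu : u₁ ≤ u₂) (hv : v₁ ≤ v₂) :
    J4 Δ₂ a₁ u₂ v₂ ≤ J4 Δ₁ a₂ u₁ v₁ := by
  unfold J4
  have hΔ₂ : 0 < Δ₂ := lt_of_lt_of_le hΔ₁ hΔ
  have hc₂ : 0 ≤ chan Δ₂ u₂ v₂ := (chan_pos hΔ₂ (lt_of_lt_of_le hu₁ hu) (hv₁.trans hv)).le
  have hc : chan Δ₂ u₂ v₂ ≤ chan Δ₁ u₁ v₁ := chan_anti hΔ₁ hu₁ hv₁ hΔ hu hv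
  have h1 : 4 * a₁ ^ 4 / Δ₂ ^ 2 ≤ 4 * a₂ ^ 4 / Δ₁ ^ 2 := by gcongr
  have h2 : 0 ≤ 4 * a₂ ^ 4 / Δ₁ ^ 2 := by positivity
  calc 4 * a₁ ^ 4 / Δ₂ ^ 2 * chan Δ₂ u₂ v₂ ≤ 4 * a₂ ^ 4 / Δ₁ ^ 2 * chan Δ₂ u₂ v₂ :=
        mul_le_mul_of_nonneg_right h1 hc₂
    _ ≤ 4 * a₂ ^ 4 / Δ₁ ^ 2 * chan Δ₁ u₁ v₁ := mul_le_mul_of_nonneg_left hc h2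

/-- `U_eff` is non-decreasing in `Δ`, `U_d`, `U_p` on the positive orthant. -/
theorem Ueff_mono {Δ₁ Δ₂ u₁ u₂ v₁ v₂ : ℝ} (hΔ₁ : 0 < Δ₁) (hu₁ : 0 < u₁) (hv₁ : 0 ≤ v₁)
    (hΔ : Δ₁ ≤ Δ₂) (hu : u₁ ≤ u₂) (hv : v₁ ≤ v₂) : Ueff Δ₁ u₁ v₁ ≤ Ueff Δ₂ u₂ v₂ := by
  unfold Ueff
  have hc₂ : 0 < chan Δ₂ u₂ v₂ :=
    chan_pos (lt_of_lt_of_le hΔ₁ hΔ) (lt_of_lt_of_le hu₁ hu) (hv₁.trans hv)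
  have hc : chan Δ₂ u₂ v₂ ≤ chan Δ₁ u₁ v₁ := chan_anti hΔ₁ hu₁ hv₁ hΔ hu hv
  gcongr

/-- CORNER ENCLOSURE for `t_ZR` on the box `Δ ∈ [Δlo, Δhi]`, `t_pd ∈ [alo, ahi]` (`Δlo > 0`,
`alo ≥ 0`): `t_ZR(Δhi, alo) ≤ t_ZR(Δ, t_pd) ≤ t_ZR(Δlo, ahi)`. -/
theorem tZR_mem_Icc_of_box {Δlo Δhi alo ahi Δ a : ℝ} (hΔlo : 0 < Δlo) (halo : 0 ≤ alo)
    (hΔ : Δ ∈ Set.Icc Δlo Δhi) (ha : a ∈ Set.Icc alo ahi) :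
    tZR Δ a ∈ Set.Icc (tZR Δhi alo) (tZR Δlo ahi) :=
  ⟨tZR_mono (lt_of_lt_of_le hΔlo hΔ.1) halo ha.1 hΔ.2,
    tZR_mono hΔlo (halo.trans ha.1) ha.2 hΔ.1⟩

/-- CORNER ENCLOSURE for `J₄` on the box `[Δlo,Δhi] × [alo,ahi] × [ulo,uhi] × [vlo,vhi]`
(`Δlo > 0`, `alo ≥ 0`, `ulo > 0`, `vlo ≥ 0`): two opposite-corner evaluations enclose the image,
`J₄(Δhi, alo, uhi, vhi) ≤ J₄(Δ, t_pd, U_d, U_p) ≤ J₄(Δlo, ahi, ulo, vlo)`. -/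
theorem J4_mem_Icc_of_box {Δlo Δhi alo ahi ulo uhi vlo vhi Δ a u v : ℝ} (hΔlo : 0 < Δlo)
    (halo : 0 ≤ alo) (hulo : 0 < ulo) (hvlo : 0 ≤ vlo) (hΔ : Δ ∈ Set.Icc Δlo Δhi)
    (ha : a ∈ Set.Icc alo ahi) (hu : u ∈ Set.Icc ulo uhi) (hv : v ∈ Set.Icc vlo vhi) :
    J4 Δ a u v ∈ Set.Icc (J4 Δhi alo uhi vhi) (J4 Δlo ahi ulo vlo) :=
  ⟨J4_mono (lt_of_lt_of_le hΔlo hΔ.1) halo (lt_of_lt_of_le hulo hu.1) (hvlo.trans hv.1)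
      hΔ.2 ha.1 hu.2 hv.2,
    J4_mono hΔlo (halo.trans ha.1) hulo hvlo hΔ.1 ha.2 hu.1 hv.1⟩

/-- CORNER ENCLOSURE for `U_eff` on `[Δlo,Δhi] × [ulo,uhi] × [vlo,vhi]` (`Δlo, ulo > 0`,
`vlo ≥ 0`): `U_eff(Δlo, ulo, vlo) ≤ U_eff(Δ, U_d, U_p) ≤ U_eff(Δhi, uhi, vhi)`. -/
theorem Ueff_mem_Icc_of_box {Δlo Δhi ulo uhi vlo vhi Δ u v : ℝ} (hΔlo : 0 < Δlo)
    (hulo : 0 < ulo) (hvlo : 0 ≤ vlo) (hΔ : Δ ∈ Set.Icc Δlo Δhi) (hu : u ∈ Set.Icc ulo uhi)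
    (hv : v ∈ Set.Icc vlo vhi) :
    Ueff Δ u v ∈ Set.Icc (Ueff Δlo ulo vlo) (Ueff Δhi uhi vhi) :=
  ⟨Ueff_mono hΔlo hulo hvlo hΔ.1 hu.1 hv.1,
    Ueff_mono (lt_of_lt_of_le hΔlo hΔ.1) (lt_of_lt_of_le hulo hu.1) (hvlo.trans hv.1)
      hΔ.2 hu.2 hv.2⟩

/-- Sanity evaluation at the HSSJ parameter set `(Δ, t_pd, U_d, U_p) = (3.6, 1.3, 10.5, 4)` eV
[Dagotto RMP 66 (1994) p. 9]: `J₄ ∈ (0.24, 0.25)` eV — about twice the cluster-ED value 0.128 eV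
of the same set, which is why the cell file uses these forms for signs and sensitivities only. -/
example : (0.24 : ℝ) < J4 3.6 1.3 10.5 4 ∧ J4 3.6 1.3 10.5 4 < 0.25 := by
  constructor <;> norm_num [J4, chan]

end EmeryCell

end Summit.Ventures.CertifiedManyBodySolver.Downfold
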